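import Summits.QuantumFields.YangMills.Theorems.UnitScaleTiltSU2NearCommuting
import Summits.QuantumFields.YangMills.Theorems.CovariantDischargeFramedPlaquetteTransport
import Literature.MathematicalPhysics.QuantumFieldTheory.Balaban1983to89.T4WilsonGaugeFlatDirection
import Literature.MathematicalPhysics.QuantumFieldTheory.Balaban1983to89.MatrixLogLipschitz
import Literature.Analysis.Complex.RungeUnits
import HarnessLib

/-!
# `UnitScaleTiltSU2FractionalPowers` — THE ONE-PARAMETER SUBGROUP THROUGH A NEAR-IDENTITY ELEMENT OF `SU(2)` («fractional powers» `r^s`), ITS SIZE, GROUP LAW,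
# COMMUTATOR AND LIPSCHITZ ROWS (route `UnitScaleTilt`, crux K1′ `MinimiserStabilityRegPr` stmt-QuantumFields-19200, small-member exit (α)(b), piece P3-F4a:
# the SU(2) letters of the «spreading» step F4 that makes the toron gauge η-relative on EVERY bond)

Cell `ym3-torus` (YM ladder rung R3 = continuum SU(2) Yang–Mills on T³ — a RUNG, NOT the Clay problem: not d = 4, not infinite volume, not a mass gap); width seat
`ym-ust-19200-w5` (gen 14); helper `--supports stmt-QuantumFields-19200`, count-neutral.  THEOREMS ONLY (0 `def`, 0 `sorry`, default heartbeats).  The F4 split of record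
(bus 2026-08-30 03:36–03:39Z): F4a = this file (w5 g14), F4b = the lattice spreading `…ToronGaugeSpread` (px19 g12) over ✓`TorusWrapHolonomies` (F1), ✓`SU2NearCommuting` (F2),
`ToronGauge` (F3).

WHY (the η-count, w5 g14 `LOCATE-ALPHA-B-ETA` = 19200 evidence): every comparison row of the (α)(b) knit (✓`Prop7LocalHessianComparison`, ✓`Prop7LocalDivergenceComparison` and their
two-background editions) charges the bondwise distance `δ_b` of the gauged member to the toron through `(η⁻¹δ_b)²`; F3's gauge is `∝ η` off the wrap face but `η⁰` on it, so the wrap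
residual `r` must be SPREAD along its direction by the gauge `x ↦ r^{−val(x_μ)∕N}`.  This file supplies the group-theoretic letters of that step.

THE LETTER (NO `def`; px19 g12's inline term adopted verbatim): for `r : SU(2)` and `s : ℝ`,
  `r^s := quatToSU2 (exp (s • qlog (su2Quat r)))`
— the tree's quaternion model (`su2Quat : SU(2) → S³ ⊂ ℍ`, `quatToSU2`, lit ✓`T4QuatExpLog.qlog` = the series logarithm read in `ℍ`, Mathlib `NormedSpace.exp`).  Standing
hypothesis `dist1 r ≤ 1∕2` (`dist1 r = ‖su2Quat r − 1‖`, lit ✓`dist1_eq_norm_su2Quat_sub_one`), under which `qlog (su2Quat r)` is imaginary with `‖qlog (su2Quat r)‖ ≤ 2·dist1 r ≤ 1`.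

CONTENT.
* §1 `re_qlog_su2Quat`, `norm_qlog_su2Quat_le` (`≤ 2·dist1 r`), `norm_exp_smul_qlog` (`= 1`), ★`su2Quat_fracPow` (`su2Quat (r^s) = exp (s • qlog (su2Quat r))`) (injectivity of `su2Quat`:
  lit ✓`T4WilsonGaugeFlatDirection.su2Quat_injective`, reused).
* §2 the one-parameter group: `fracPow_zero` (`r^0 = 1`), ★`fracPow_one` (`r^1 = r`), ★`fracPow_add` (`r^{s+t} = r^s·r^t`), `fracPow_neg` (`r^{−s} = (r^s)⁻¹`), `fracPow_natCast_mul`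
  (`r^{k·s} = (r^s)^k`), ★`fracPow_inv_natCast_pow` (`(r^{1∕N})^N = r`).
* §3 size: ★`dist1_fracPow_le` (`dist1 (r^s) ≤ 2|s|·dist1 r`).
* §4 the commutator row is ✓`CovariantDischargeFramedPlaquetteTransport.dist1_comm_le` (`dist1 (XYX⁻¹Y⁻¹) ≤ 2·dist1 X·dist1 Y`, reused BY NAME, imported here), the inverse row lit ✓`B11GaugeGlue.dist1_inv_mul_eq`
  (`dist1 (X⁻¹Y) = dist1 (XY⁻¹)`, not imported); `dist1_cosSin_le` (`dist1 (D θ) ≤ |θ|` for the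
  diagonal torus `D θ = quatToSU2 ⟨cos θ, sin θ, 0, 0⟩` of F2∕F3).
* §5 Lipschitz: `norm_exp_sub_exp_le_quat` (`‖eˣ − eʸ‖ ≤ ‖x − y‖·e^{max ‖x‖ ‖y‖}` in `ℍ`, through the isometric dictionary `quatMatrix` onto lit ✓`Literature.Analysis.Complex.norm_exp_sub_exp_le`),
  `norm_qlog_sub_qlog_le` (`‖qlog u − qlog v‖ ≤ 2‖u − v‖` on `‖· − 1‖ ≤ 1∕2`, onto lit ✓`MatrixLogLipschitz.norm_mlog_sub_mlog_le`), ★★`dist1_fracPow_mul_fracPow_inv_le`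
  (`dist1 (r₁^s·(r₂^s)⁻¹) ≤ 6·s·dist1 (r₁r₂⁻¹)` for `s ∈ [0,1]`: the constant is `2e ≤ 6`).

HONEST SCOPE.  Compact-group calculus in the quaternion model; nothing of F4b, (α)(a)'s twisted coercivity, `hT₂`, `hGF`, EX, `MinimiserStabilityRegPr` (19200) or the rung `YM3TorusSU2`
is proved; no summit statement is proved; the Yang–Mills mass gap is NOT proved.
References: [Balaban1985Averaging] (19) p. 21 (the invariant metric), (21) p. 21 (the series logarithm); [BrockerTomDieck1985] IV (2.2) (maximal torus of SU(2)); folklore.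
-/

noncomputable section

set_option autoImplicit false

open NormedSpace (exp)
open Quaternion
open scoped Matrix.Norms.L2Operator
open Literature.MathematicalPhysics.QuantumLattice (su2Quat quatToSU2 norm_su2Quat quatToSU2_su2Quat quatMatrix)
open Literature.MathematicalPhysics.QuantumFieldTheory.Balaban1983to89
open Literature.MathematicalPhysics.QuantumFieldTheory.Balaban1983to89.T4QuatExpLog (qlog exp_qlog norm_qlog_le qlog_re_of_norm_eq_one norm_exp_of_re_eq_zero
  norm_exp_sub_one_le quatMatrix_exp quatMatrix_qlog norm_quatMatrix quatMatrix_sub)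
open Literature.MathematicalPhysics.QuantumFieldTheory.Balaban1983to89.T4CubeChartGnomonic (SU2)
open Literature.MathematicalPhysics.QuantumFieldTheory.Balaban1983to89.T4ExpWindowSmallField (dist1_eq_norm_su2Quat_sub_one)
open Literature.MathematicalPhysics.QuantumFieldTheory.Balaban1983to89.T4HaarSU2Translate (su2Quat_mul su2Quat_one su2Quat_quatToSU2)
open Literature.MathematicalPhysics.QuantumFieldTheory.Balaban1983to89.T4WilsonLinkAffine (su2Quat_inv)
open Literature.MathematicalPhysics.QuantumFieldTheory.Balaban1983to89.T4WilsonGaugeFlatDirection (su2Quat_injective)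
open Summit.QuantumFields.YangMills.Theorems.SU2NearCommuting (dist1_mul_inv_eq_norm_sub)

namespace Summit.QuantumFields.YangMills.Theorems.SU2FractionalPowers

/-! ## §1 The logarithm of a near-identity element of `SU(2)` in the quaternion model -/

/-- `dist1 r ≤ 1∕2 ⇒ ‖su2Quat r − 1‖ < 1` (the logarithm's disc). [cite: Balaban1985Averaging, (19) p.21] -/
theorem norm_su2Quat_sub_one_lt_one {r : SU2} (hr : dist1 r ≤ 1 / 2) : ‖su2Quat r - 1‖ < 1 := by
  rw [← dist1_eq_norm_su2Quat_sub_one]; linarith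

/-- The logarithm of a unit quaternion near `1` is IMAGINARY. [folklore] -/
theorem re_qlog_su2Quat {r : SU2} (hr : dist1 r ≤ 1 / 2) : (qlog (su2Quat r)).re = 0 :=
  qlog_re_of_norm_eq_one (norm_su2Quat r) (norm_su2Quat_sub_one_lt_one hr)

/-- `‖qlog (su2Quat r)‖ ≤ 2·dist1 r` on `dist1 r ≤ 1∕2` (`t∕(1 − t) ≤ 2t` for `t ≤ 1∕2`). [cite: Balaban1985Averaging, (21), (26) pp.21–22] -/
theorem norm_qlog_su2Quat_le {r : SU2} (hr : dist1 r ≤ 1 / 2) : ‖qlog (su2Quat r)‖ ≤ 2 * dist1 r := by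
  have h1 := norm_su2Quat_sub_one_lt_one hr
  have ht : ‖su2Quat r - 1‖ ≤ 1 / 2 := by rwa [← dist1_eq_norm_su2Quat_sub_one]
  have h0 : 0 ≤ ‖su2Quat r - 1‖ := norm_nonneg _
  calc ‖qlog (su2Quat r)‖ ≤ ‖su2Quat r - 1‖ / (1 - ‖su2Quat r - 1‖) := norm_qlog_le h1
    _ ≤ 2 * ‖su2Quat r - 1‖ := by
        rw [div_le_iff₀ (by linarith)]
        nlinarith
    _ = 2 * dist1 r := by rw [dist1_eq_norm_su2Quat_sub_one]

/-- `‖qlog (su2Quat r)‖ ≤ 1` on `dist1 r ≤ 1∕2`. [folklore] -/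
theorem norm_qlog_su2Quat_le_one {r : SU2} (hr : dist1 r ≤ 1 / 2) : ‖qlog (su2Quat r)‖ ≤ 1 :=
  (norm_qlog_su2Quat_le hr).trans (by linarith)

/-- The exponent `s • qlog (su2Quat r)` is imaginary. [folklore] -/
theorem re_smul_qlog_su2Quat {r : SU2} (hr : dist1 r ≤ 1 / 2) (s : ℝ) : (s • qlog (su2Quat r)).re = 0 := by
  rw [Quaternion.re_smul, re_qlog_su2Quat hr, smul_zero]

/-- `‖exp (s • qlog (su2Quat r))‖ = 1`: the one-parameter subgroup stays on `S³`. [folklore] -/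
theorem norm_exp_smul_qlog {r : SU2} (hr : dist1 r ≤ 1 / 2) (s : ℝ) : ‖exp (s • qlog (su2Quat r))‖ = 1 :=
  norm_exp_of_re_eq_zero (re_smul_qlog_su2Quat hr s)

/-- `su2Quat (quatToSU2 q) = q` for a UNIT quaternion. [folklore] -/
theorem su2Quat_quatToSU2_of_norm_eq_one {q : ℍ} (hq : ‖q‖ = 1) : su2Quat (quatToSU2 q) = q := by
  have hq0 : q ≠ 0 := by
    intro h; rw [h, norm_zero] at hq; exact zero_ne_one hq
  rw [su2Quat_quatToSU2 hq0, hq, inv_one, one_smul]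

/-- ★ **THE LETTER**: `su2Quat (r^s) = exp (s • qlog (su2Quat r))`, `r^s := quatToSU2 (exp (s • qlog (su2Quat r)))`. [folklore] -/
theorem su2Quat_fracPow {r : SU2} (hr : dist1 r ≤ 1 / 2) (s : ℝ) :
    su2Quat (quatToSU2 (exp (s • qlog (su2Quat r)))) = exp (s • qlog (su2Quat r)) :=
  su2Quat_quatToSU2_of_norm_eq_one (norm_exp_smul_qlog hr s)

/-! ## §2 The one-parameter group `s ↦ r^s` -/

/-- `r^0 = 1`. [folklore] -/
theorem fracPow_zero (r : SU2) : quatToSU2 (exp ((0 : ℝ) • qlog (su2Quat r))) = 1 := by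
  apply su2Quat_injective
  rw [zero_smul, NormedSpace.exp_zero, su2Quat_quatToSU2_of_norm_eq_one norm_one, su2Quat_one]

/-- ★ `r^1 = r` (`exp ∘ qlog = id` on the disc). [folklore] -/
theorem fracPow_one {r : SU2} (hr : dist1 r ≤ 1 / 2) : quatToSU2 (exp ((1 : ℝ) • qlog (su2Quat r))) = r := by
  rw [one_smul, exp_qlog (norm_su2Quat_sub_one_lt_one hr), quatToSU2_su2Quat]

/-- ★ **GROUP LAW**: `r^{s+t} = r^s · r^t` (commuting exponents). [folklore] -/
theorem fracPow_add {r : SU2} (hr : dist1 r ≤ 1 / 2) (s t : ℝ) :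
    quatToSU2 (exp ((s + t) • qlog (su2Quat r))) = quatToSU2 (exp (s • qlog (su2Quat r))) * quatToSU2 (exp (t • qlog (su2Quat r))) := by
  apply su2Quat_injective
  rw [su2Quat_mul, su2Quat_fracPow hr, su2Quat_fracPow hr, su2Quat_fracPow hr, add_smul]
  -- Mathlib's `exp_add_of_commute` wants a `ℚ`-algebra structure (as in `Quaternion.exp_eq`)
  letI : NormedAlgebra ℚ ℍ := NormedAlgebra.restrictScalars ℚ ℝ ℍ
  exact NormedSpace.exp_add_of_commute (((Commute.refl (qlog (su2Quat r))).smul_left s).smul_right t)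

/-- `r^{−s} = (r^s)⁻¹`. [folklore] -/
theorem fracPow_neg {r : SU2} (hr : dist1 r ≤ 1 / 2) (s : ℝ) :
    quatToSU2 (exp ((-s) • qlog (su2Quat r))) = (quatToSU2 (exp (s • qlog (su2Quat r))))⁻¹ := by
  rw [eq_inv_iff_mul_eq_one, ← fracPow_add hr, neg_add_cancel, fracPow_zero]

/-- `r^{k·s} = (r^s)^k` for `k : ℕ`. [folklore] -/
theorem fracPow_natCast_mul {r : SU2} (hr : dist1 r ≤ 1 / 2) (s : ℝ) (k : ℕ) :
    quatToSU2 (exp (((k : ℝ) * s) • qlog (su2Quat r))) = (quatToSU2 (exp (s • qlog (su2Quat r)))) ^ k := by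
  induction k with
  | zero => rw [Nat.cast_zero, zero_mul, fracPow_zero, pow_zero]
  | succ k ih => rw [Nat.cast_succ, add_mul, one_mul, fracPow_add hr, ih, pow_succ]

/-- ★ **THE `N`-TH ROOT**: `(r^{1∕N})^N = r` for `N ≠ 0`. [folklore] -/
theorem fracPow_inv_natCast_pow {r : SU2} (hr : dist1 r ≤ 1 / 2) {N : ℕ} (hN : N ≠ 0) :
    (quatToSU2 (exp (((N : ℝ)⁻¹) • qlog (su2Quat r)))) ^ N = r := by
  rw [← fracPow_natCast_mul hr, mul_inv_cancel₀ (Nat.cast_ne_zero.mpr hN), fracPow_one hr]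

/-- `r^{k∕N}` as a power of the root: `r^{k∕N} = (r^{1∕N})^k`. [folklore] -/
theorem fracPow_div_natCast {r : SU2} (hr : dist1 r ≤ 1 / 2) (k N : ℕ) :
    quatToSU2 (exp (((k : ℝ) / (N : ℝ)) • qlog (su2Quat r))) = (quatToSU2 (exp (((N : ℝ)⁻¹) • qlog (su2Quat r)))) ^ k := by
  rw [div_eq_mul_inv, fracPow_natCast_mul hr]

/-! ## §3 Size: `dist1 (r^s) ≤ 2|s|·dist1 r` -/

/-- ★ **SIZE OF THE FRACTIONAL POWER**: `dist1 (r^s) ≤ 2·|s|·dist1 r` on `dist1 r ≤ 1∕2` (`‖e^w − 1‖ ≤ ‖w‖` for imaginary `w`, `‖qlog‖ ≤ 2·dist1`). In particular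
`dist1 (r^{1∕N}) ≤ 2·dist1 r ∕ N` — the spreading gain. [cite: Balaban1985Averaging, (19), (21) p.21] -/
theorem dist1_fracPow_le {r : SU2} (hr : dist1 r ≤ 1 / 2) (s : ℝ) :
    dist1 (quatToSU2 (exp (s • qlog (su2Quat r)))) ≤ 2 * |s| * dist1 r := by
  rw [dist1_eq_norm_su2Quat_sub_one, su2Quat_fracPow hr]
  calc ‖exp (s • qlog (su2Quat r)) - 1‖ ≤ ‖s • qlog (su2Quat r)‖ := norm_exp_sub_one_le (re_smul_qlog_su2Quat hr s)
    _ = |s| * ‖qlog (su2Quat r)‖ := by rw [norm_smul, Real.norm_eq_abs]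
    _ ≤ |s| * (2 * dist1 r) := mul_le_mul_of_nonneg_left (norm_qlog_su2Quat_le hr) (abs_nonneg s)
    _ = 2 * |s| * dist1 r := by ring

/-- The root stays in the disc: `dist1 (r^s) ≤ 1∕2` for `|s| ≤ 1∕2` — so roots of roots are again covered. [folklore] -/
theorem dist1_fracPow_le_half {r : SU2} (hr : dist1 r ≤ 1 / 2) {s : ℝ} (hs : |s| ≤ 1 / 2) :
    dist1 (quatToSU2 (exp (s • qlog (su2Quat r)))) ≤ 1 / 2 := by
  have h := dist1_fracPow_le hr s
  have h0 : 0 ≤ dist1 r := GaugeGroup.dist1_nonneg r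
  nlinarith

/-! ## §4 Commutators, inverses, the diagonal torus -/

-- COMMUTATOR ROW (already in the tree, reused BY NAME — gate dedup): ✓`CovariantDischargeFramedPlaquetteTransport.dist1_comm_le (g e : SU2) :
--   dist1 (g * e * g⁻¹ * e⁻¹) ≤ 2 * dist1 g * dist1 e` (imported above so that F4b gets it transitively).

-- INVERSE ROW (already in the tree, reused BY NAME — gate dedup): lit ✓`B11GaugeGlue.dist1_inv_mul_eq (a b : G) : dist1 (a⁻¹ * b) = dist1 (a * b⁻¹)`.

/-- `dist1 (D θ) ≤ |θ|` for the diagonal torus `D θ = quatToSU2 ⟨cos θ, sin θ, 0, 0⟩` of F2∕F3 (`‖(cos θ − 1, sin θ)‖² = 2 − 2cos θ ≤ θ²`).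
[cite: BrockerTomDieck1985, IV (2.2)] -/
theorem dist1_cosSin_le (θ : ℝ) : dist1 (quatToSU2 (⟨Real.cos θ, Real.sin θ, 0, 0⟩ : ℍ)) ≤ |θ| := by
  set dq : ℍ := ⟨Real.cos θ, Real.sin θ, 0, 0⟩ with hdq
  have h1 : ‖dq‖ = 1 := by
    have h : ‖dq‖ ^ 2 = 1 := by
      rw [sq, ← Quaternion.normSq_eq_norm_mul_self, Quaternion.normSq_def', hdq]
      simp only
      nlinarith [Real.cos_sq_add_sin_sq θ]
    nlinarith [norm_nonneg dq]
  rw [dist1_eq_norm_su2Quat_sub_one, su2Quat_quatToSU2_of_norm_eq_one h1]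
  have h2 : ‖dq - 1‖ ^ 2 ≤ |θ| ^ 2 := by
    rw [sq_abs, sq, ← Quaternion.normSq_eq_norm_mul_self, Quaternion.normSq_def']
    have hre : (dq - 1).re = Real.cos θ - 1 := by simp [hdq]
    have hi : (dq - 1).imI = Real.sin θ := by simp [hdq]
    have hj : (dq - 1).imJ = 0 := by simp [hdq]
    have hk : (dq - 1).imK = 0 := by simp [hdq]
    rw [hre, hi, hj, hk]
    nlinarith [Real.cos_sq_add_sin_sq θ, Real.one_sub_sq_div_two_le_cos (x := θ)]
  exact (pow_le_pow_iff_left₀ (norm_nonneg _) (abs_nonneg θ) two_ne_zero).1 h2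

/-! ## §5 Lipschitz rows -/

/-- **`exp` IS LOCALLY LIPSCHITZ ON `ℍ`**: `‖eˣ − eʸ‖ ≤ ‖x − y‖·e^{max ‖x‖ ‖y‖}` — through the isometric ring homomorphism `quatMatrix : ℍ → M₂(ℂ)` (lit ✓`norm_quatMatrix`, ✓`quatMatrix_exp`)
onto lit ✓`Literature.Analysis.Complex.norm_exp_sub_exp_le`. [folklore] -/
theorem norm_exp_sub_exp_le_quat (x y : ℍ) : ‖exp x - exp y‖ ≤ ‖x - y‖ * Real.exp (max ‖x‖ ‖y‖) := by
  rw [← norm_quatMatrix, quatMatrix_sub, quatMatrix_exp, quatMatrix_exp, ← norm_quatMatrix (x - y), quatMatrix_sub, ← norm_quatMatrix x,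
    ← norm_quatMatrix y]
  exact Literature.Analysis.Complex.norm_exp_sub_exp_le _ _

/-- **`qlog` IS `2`-LIPSCHITZ ON `‖· − 1‖ ≤ 1∕2`**: `‖qlog u − qlog v‖ ≤ 2‖u − v‖` — through `quatMatrix` (lit ✓`quatMatrix_qlog`) onto lit ✓`MatrixLogLipschitz.norm_mlog_sub_mlog_le`
at `r = 1∕2`. [cite: Balaban1985Averaging, (21) p.21] -/
theorem norm_qlog_sub_qlog_le {u v : ℍ} (hu : ‖u - 1‖ ≤ 1 / 2) (hv : ‖v - 1‖ ≤ 1 / 2) : ‖qlog u - qlog v‖ ≤ 2 * ‖u - v‖ := by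
  have hu1 : ‖u - 1‖ < 1 := lt_of_le_of_lt hu (by norm_num)
  have hv1 : ‖v - 1‖ < 1 := lt_of_le_of_lt hv (by norm_num)
  have hA : ‖quatMatrix u - 1‖ ≤ 1 / 2 := by rwa [T4QuatExpLog.norm_quatMatrix_sub_one]
  have hB : ‖quatMatrix v - 1‖ ≤ 1 / 2 := by rwa [T4QuatExpLog.norm_quatMatrix_sub_one]
  rw [← norm_quatMatrix, quatMatrix_sub, quatMatrix_qlog hu1, quatMatrix_qlog hv1]
  calc ‖MatrixLog.mlog (quatMatrix u) - MatrixLog.mlog (quatMatrix v)‖ ≤ ‖quatMatrix u - quatMatrix v‖ / (1 - 1 / 2) :=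
        MatrixLogLipschitz.norm_mlog_sub_mlog_le (by norm_num) hA hB
    _ = 2 * ‖u - v‖ := by rw [← quatMatrix_sub, norm_quatMatrix]; ring

/-- ★★ **THE LIPSCHITZ ROW OF THE FRACTIONAL POWER IN ITS BASE POINT**: for `r₁ r₂ ∈ SU(2)` with `dist1 rᵢ ≤ 1∕2` and `s ∈ [0, 1]`,
`dist1 (r₁^s · (r₂^s)⁻¹) ≤ 6·s·dist1 (r₁·r₂⁻¹)` (`dist1 (UV⁻¹) = ‖q_U − q_V‖`; `‖e^{sw₁} − e^{sw₂}‖ ≤ s‖w₁ − w₂‖e^{s·max‖wᵢ‖} ≤ s·e·2‖q₁ − q₂‖`, `2e ≤ 6`).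
This is the row F4b needs on the TRANSVERSE bonds: the spreading gauges of two neighbouring lines differ by the fractional powers of two `O(η)`-close residuals.
[cite: Balaban1985Averaging, (19), (21) p.21] -/
theorem dist1_fracPow_mul_fracPow_inv_le {r₁ r₂ : SU2} (hr₁ : dist1 r₁ ≤ 1 / 2) (hr₂ : dist1 r₂ ≤ 1 / 2) {s : ℝ} (hs0 : 0 ≤ s) (hs1 : s ≤ 1) :
    dist1 (quatToSU2 (exp (s • qlog (su2Quat r₁))) * (quatToSU2 (exp (s • qlog (su2Quat r₂))))⁻¹) ≤ 6 * s * dist1 (r₁ * r₂⁻¹) := by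
  rw [dist1_mul_inv_eq_norm_sub, su2Quat_fracPow hr₁, su2Quat_fracPow hr₂, dist1_mul_inv_eq_norm_sub]
  have hq₁ : ‖su2Quat r₁ - 1‖ ≤ 1 / 2 := by rwa [← dist1_eq_norm_su2Quat_sub_one]
  have hq₂ : ‖su2Quat r₂ - 1‖ ≤ 1 / 2 := by rwa [← dist1_eq_norm_su2Quat_sub_one]
  have hw₁ : ‖s • qlog (su2Quat r₁)‖ ≤ 1 := by
    rw [norm_smul, Real.norm_eq_abs, abs_of_nonneg hs0]
    calc s * ‖qlog (su2Quat r₁)‖ ≤ 1 * 1 := mul_le_mul hs1 (norm_qlog_su2Quat_le_one hr₁) (norm_nonneg _) zero_le_one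
      _ = 1 := one_mul 1
  have hw₂ : ‖s • qlog (su2Quat r₂)‖ ≤ 1 := by
    rw [norm_smul, Real.norm_eq_abs, abs_of_nonneg hs0]
    calc s * ‖qlog (su2Quat r₂)‖ ≤ 1 * 1 := mul_le_mul hs1 (norm_qlog_su2Quat_le_one hr₂) (norm_nonneg _) zero_le_one
      _ = 1 := one_mul 1
  have hmax : Real.exp (max ‖s • qlog (su2Quat r₁)‖ ‖s • qlog (su2Quat r₂)‖) ≤ 3 := by
    calc Real.exp (max ‖s • qlog (su2Quat r₁)‖ ‖s • qlog (su2Quat r₂)‖) ≤ Real.exp 1 := Real.exp_le_exp.mpr (max_le hw₁ hw₂)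
      _ ≤ 3 := by
          have := Real.exp_one_lt_d9
          linarith
  have hlog : ‖qlog (su2Quat r₁) - qlog (su2Quat r₂)‖ ≤ 2 * ‖su2Quat r₁ - su2Quat r₂‖ := norm_qlog_sub_qlog_le hq₁ hq₂
  have hdiff : ‖s • qlog (su2Quat r₁) - s • qlog (su2Quat r₂)‖ ≤ s * (2 * ‖su2Quat r₁ - su2Quat r₂‖) := by
    rw [← smul_sub, norm_smul, Real.norm_eq_abs, abs_of_nonneg hs0]
    exact mul_le_mul_of_nonneg_left hlog hs0
  have h0 : 0 ≤ ‖s • qlog (su2Quat r₁) - s • qlog (su2Quat r₂)‖ := norm_nonneg _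
  have hd0 : 0 ≤ ‖su2Quat r₁ - su2Quat r₂‖ := norm_nonneg _
  calc ‖exp (s • qlog (su2Quat r₁)) - exp (s • qlog (su2Quat r₂))‖
        ≤ ‖s • qlog (su2Quat r₁) - s • qlog (su2Quat r₂)‖ * Real.exp (max ‖s • qlog (su2Quat r₁)‖ ‖s • qlog (su2Quat r₂)‖) := norm_exp_sub_exp_le_quat _ _
    _ ≤ (s * (2 * ‖su2Quat r₁ - su2Quat r₂‖)) * 3 := mul_le_mul hdiff hmax (Real.exp_pos _).le (by positivity)
    _ = 6 * s * ‖su2Quat r₁ - su2Quat r₂‖ := by ring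

/-- The same row with `s ≤ 1` absorbed: `dist1 (r₁^s·(r₂^s)⁻¹) ≤ 6·dist1 (r₁·r₂⁻¹)`. [cite: Balaban1985Averaging, (19), (21) p.21] -/
theorem dist1_fracPow_mul_fracPow_inv_le' {r₁ r₂ : SU2} (hr₁ : dist1 r₁ ≤ 1 / 2) (hr₂ : dist1 r₂ ≤ 1 / 2) {s : ℝ} (hs0 : 0 ≤ s) (hs1 : s ≤ 1) :
    dist1 (quatToSU2 (exp (s • qlog (su2Quat r₁))) * (quatToSU2 (exp (s • qlog (su2Quat r₂))))⁻¹) ≤ 6 * dist1 (r₁ * r₂⁻¹) := by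
  have h := dist1_fracPow_mul_fracPow_inv_le hr₁ hr₂ hs0 hs1
  have h0 : 0 ≤ dist1 (r₁ * r₂⁻¹) := GaugeGroup.dist1_nonneg _
  nlinarith

end Summit.QuantumFields.YangMills.Theorems.SU2FractionalPowers

end
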